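import Mathlib
import HarnessLib

/-!
# `NoHeavyLowerTail` (stmt-CriticalPhenomena-4575) — the pool bound for a partner group (U1-PROOF L7.2, L7.3(i))

Support file (prover `prim-gen-swap` gen 13; `--supports stmt-CriticalPhenomena-4575`).  No definitions, no named facts, no sorries.

Abstract real inequalities behind Lemma L7.2 and L7.3(i) of the seat memo U1-PROOF.md (§7 "the pool" of the proof of the r-avoiding
MWF supply inequality U1′_r).  A partner class `J` has a finite group `𝒳` of hubs `X` with weights `t_X ≥ 0`; "triangle pairs" form a
partial MATCHING `M` on `𝒳` (a symmetric relation, every hub related to at most one other hub) and are the only pairs that do not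
exchange cross words.  With `s = Σ_X t_X`:

* `StarSet.sum_mul_matched_le_sum_sq` — `Σ_X t_X · Σ_{Y ≠ X, M X Y} t_Y ≤ Σ_X t_X²` (each hub matched at most once);
* `StarSet.pool_group_sq_le` — `s² ≤ 2 Σ_X t_X (t_X + Σ_{Y ≠ X, ¬M X Y} t_Y)` (L7.2: `Σt² + unmatched cross ≥ max(Σt², s² − Σt²)`);
* `StarSet.pool_group_need_le` — `Σ_X t_X [1 − c (t_X + Σ_{Y ≠ X, ¬M X Y} t_Y)]⁺ ≤ 1/(2c)` for `c > 0` (L7.2 with `c = P − 1`,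
  after restriction to the hubs with positive bracket);
* `StarSet.pool_cold_need_le` — `Σ_X t_X [1 − P t_X − ½ P (s' − t_X)]⁺ ≤ 1/(2P)` for `s' ≥ s`, `P > 0` (cold hubs of L7.3(i));
* `StarSet.pool_cold_total_le_half` — `(P−1−T)/(2(P−1)) + T/(2P) ≤ 1/2` for `P > 1`, `T ≥ 0` (the total of L7.3(i)).
-/

namespace Summit.CriticalPhenomena.PercolationContinuityZ3.Theorems

open Finset
open scoped BigOperators

namespace StarSet

variable {ι : Type*}

/-- **Matched cross terms are at most the sum of squares**: if every hub is `M`-related to at most one other hub and `M` is symmetric,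
`Σ_X t_X Σ_{Y ≠ X, M X Y} t_Y ≤ Σ_X t_X²`. [U1-PROOF.md L7.2] -/
theorem sum_mul_matched_le_sum_sq [DecidableEq ι] (𝒳 : Finset ι) (t : ι → ℝ)
    (M : ι → ι → Prop) [DecidableRel M] (hMsymm : ∀ X ∈ 𝒳, ∀ Y ∈ 𝒳, M X Y → M Y X)
    (hMuniq : ∀ X ∈ 𝒳, ({Y ∈ 𝒳 | Y ≠ X ∧ M X Y} : Finset ι).card ≤ 1) :
    ∑ X ∈ 𝒳, t X * ∑ Y ∈ 𝒳 with (Y ≠ X ∧ M X Y), t Y ≤ ∑ X ∈ 𝒳, t X ^ 2 := by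
  classical
  -- `t_X t_Y ≤ (t_X² + t_Y²)/2` termwise
  have hterm : ∑ X ∈ 𝒳, t X * ∑ Y ∈ 𝒳 with (Y ≠ X ∧ M X Y), t Y ≤
      ∑ X ∈ 𝒳, ∑ Y ∈ 𝒳 with (Y ≠ X ∧ M X Y), (t X ^ 2 / 2 + t Y ^ 2 / 2) := by
    refine sum_le_sum fun X _ => ?_
    rw [mul_sum]
    exact sum_le_sum fun Y _ => by nlinarith [sq_nonneg (t X - t Y)]
  refine hterm.trans ?_
  rw [show (∑ X ∈ 𝒳, ∑ Y ∈ 𝒳 with (Y ≠ X ∧ M X Y), (t X ^ 2 / 2 + t Y ^ 2 / 2)) =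
      (∑ X ∈ 𝒳, ∑ Y ∈ 𝒳 with (Y ≠ X ∧ M X Y), t X ^ 2 / 2) +
        ∑ X ∈ 𝒳, ∑ Y ∈ 𝒳 with (Y ≠ X ∧ M X Y), t Y ^ 2 / 2 by
    rw [← sum_add_distrib]; exact sum_congr rfl fun X _ => sum_add_distrib]
  -- first double sum: `≤ Σ_X t_X²/2` (at most one `Y` per `X`)
  have h1 : ∑ X ∈ 𝒳, ∑ Y ∈ 𝒳 with (Y ≠ X ∧ M X Y), t X ^ 2 / 2 ≤ ∑ X ∈ 𝒳, t X ^ 2 / 2 := by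
    refine sum_le_sum fun X hX => ?_
    rw [sum_const, nsmul_eq_mul]
    have hc : (({Y ∈ 𝒳 | Y ≠ X ∧ M X Y} : Finset ι).card : ℝ) ≤ 1 := by exact_mod_cast hMuniq X hX
    nlinarith [sq_nonneg (t X)]
  -- second double sum: swap the order of summation and use symmetry
  have h2 : ∑ X ∈ 𝒳, ∑ Y ∈ 𝒳 with (Y ≠ X ∧ M X Y), t Y ^ 2 / 2 ≤ ∑ Y ∈ 𝒳, t Y ^ 2 / 2 := by
    have hswap : ∑ X ∈ 𝒳, ∑ Y ∈ 𝒳 with (Y ≠ X ∧ M X Y), t Y ^ 2 / 2 =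
        ∑ Y ∈ 𝒳, ∑ X ∈ 𝒳 with (Y ≠ X ∧ M X Y), t Y ^ 2 / 2 := by
      simp_rw [sum_filter]
      rw [sum_comm]
    rw [hswap]
    refine sum_le_sum fun Y hY => ?_
    rw [sum_const, nsmul_eq_mul]
    have hsub : ({X ∈ 𝒳 | Y ≠ X ∧ M X Y} : Finset ι) ⊆ {X ∈ 𝒳 | X ≠ Y ∧ M Y X} := by
      intro X hX
      rw [mem_filter] at hX ⊢
      exact ⟨hX.1, Ne.symm hX.2.1, hMsymm X hX.1 Y hY hX.2.2⟩
    have hc : (({X ∈ 𝒳 | Y ≠ X ∧ M X Y} : Finset ι).card : ℝ) ≤ 1 := by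
      exact_mod_cast (card_le_card hsub).trans (hMuniq Y hY)
    nlinarith [sq_nonneg (t Y)]
  have hsum : ∑ X ∈ 𝒳, t X ^ 2 / 2 + ∑ Y ∈ 𝒳, t Y ^ 2 / 2 = ∑ X ∈ 𝒳, t X ^ 2 := by
    rw [← sum_add_distrib]; exact sum_congr rfl fun X _ => by ring
  linarith

/-- **L7.2 of U1-PROOF.md (quadratic bound for a partner group): `s² ≤ 2 Σ_X t_X (t_X + Σ_{Y ≠ X, ¬M X Y} t_Y)`.** -/
theorem pool_group_sq_le [DecidableEq ι] (𝒳 : Finset ι) (t : ι → ℝ) (ht0 : ∀ X ∈ 𝒳, 0 ≤ t X)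
    (M : ι → ι → Prop) [DecidableRel M] (hMsymm : ∀ X ∈ 𝒳, ∀ Y ∈ 𝒳, M X Y → M Y X)
    (hMuniq : ∀ X ∈ 𝒳, ({Y ∈ 𝒳 | Y ≠ X ∧ M X Y} : Finset ι).card ≤ 1) :
    (∑ X ∈ 𝒳, t X) ^ 2 ≤ 2 * ∑ X ∈ 𝒳, t X * (t X + ∑ Y ∈ 𝒳 with (Y ≠ X ∧ ¬ M X Y), t Y) := by
  classical
  set s := ∑ X ∈ 𝒳, t X with hs
  -- split `s = t_X + Σ_{Y≠X, ¬M} t_Y + Σ_{Y≠X, M} t_Y` for every `X`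
  have hsplit : ∀ X ∈ 𝒳, t X + ∑ Y ∈ 𝒳 with (Y ≠ X ∧ ¬ M X Y), t Y = s - ∑ Y ∈ 𝒳 with (Y ≠ X ∧ M X Y), t Y := by
    intro X hX
    have h1 : ∑ Y ∈ 𝒳, t Y = t X + ∑ Y ∈ 𝒳 with Y ≠ X, t Y := by
      rw [← Finset.add_sum_erase 𝒳 t hX, Finset.filter_ne']
    have h2 : ∑ Y ∈ 𝒳 with Y ≠ X, t Y =
        ∑ Y ∈ 𝒳 with (Y ≠ X ∧ M X Y), t Y + ∑ Y ∈ 𝒳 with (Y ≠ X ∧ ¬ M X Y), t Y := by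
      rw [← sum_filter_add_sum_filter_not ({Y ∈ 𝒳 | Y ≠ X} : Finset ι) (fun Y => M X Y), filter_filter, filter_filter]
    rw [hs, h1, h2]; ring
  -- (1) the expression is at least `Σ t²`
  have hge1 : ∑ X ∈ 𝒳, t X ^ 2 ≤ ∑ X ∈ 𝒳, t X * (t X + ∑ Y ∈ 𝒳 with (Y ≠ X ∧ ¬ M X Y), t Y) := by
    refine sum_le_sum fun X hX => ?_
    have hin : 0 ≤ ∑ Y ∈ 𝒳 with (Y ≠ X ∧ ¬ M X Y), t Y := sum_nonneg fun Y hY => ht0 Y (mem_filter.1 hY).1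
    nlinarith [ht0 X hX]
  -- (2) it is at least `s² − Σ t²`
  have hge2 : s ^ 2 - ∑ X ∈ 𝒳, t X ^ 2 ≤ ∑ X ∈ 𝒳, t X * (t X + ∑ Y ∈ 𝒳 with (Y ≠ X ∧ ¬ M X Y), t Y) := by
    have heq : ∑ X ∈ 𝒳, t X * (t X + ∑ Y ∈ 𝒳 with (Y ≠ X ∧ ¬ M X Y), t Y) =
        s ^ 2 - ∑ X ∈ 𝒳, t X * ∑ Y ∈ 𝒳 with (Y ≠ X ∧ M X Y), t Y := by
      rw [sum_congr rfl fun X hX => by rw [hsplit X hX], ]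
      simp_rw [mul_sub]
      rw [sum_sub_distrib, ← sum_mul, hs]; ring
    rw [heq]
    linarith [sum_mul_matched_le_sum_sq 𝒳 t M hMsymm hMuniq]
  linarith

/-- **L7.2 of U1-PROOF.md (need of a partner group): `Σ_X t_X [1 − c (t_X + Σ_{Y ≠ X, ¬M X Y} t_Y)]⁺ ≤ 1/(2c)`** (`c = P − 1 > 0`). -/
theorem pool_group_need_le [DecidableEq ι] (𝒳 : Finset ι) (t : ι → ℝ) (ht0 : ∀ X ∈ 𝒳, 0 ≤ t X)
    (M : ι → ι → Prop) [DecidableRel M] (hMsymm : ∀ X ∈ 𝒳, ∀ Y ∈ 𝒳, M X Y → M Y X)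
    (hMuniq : ∀ X ∈ 𝒳, ({Y ∈ 𝒳 | Y ≠ X ∧ M X Y} : Finset ι).card ≤ 1) (c : ℝ) (hc : 0 < c) :
    ∑ X ∈ 𝒳, t X * max 0 (1 - c * (t X + ∑ Y ∈ 𝒳 with (Y ≠ X ∧ ¬ M X Y), t Y)) ≤ 1 / (2 * c) := by
  classical
  -- restrict to the hubs with positive bracket; their brackets only grow
  set 𝒳p : Finset ι := {X ∈ 𝒳 | 0 < 1 - c * (t X + ∑ Y ∈ 𝒳 with (Y ≠ X ∧ ¬ M X Y), t Y)} with h𝒳p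
  have hsub : 𝒳p ⊆ 𝒳 := filter_subset _ _
  have hsplit : ∑ X ∈ 𝒳, t X * max 0 (1 - c * (t X + ∑ Y ∈ 𝒳 with (Y ≠ X ∧ ¬ M X Y), t Y)) =
      ∑ X ∈ 𝒳p, t X * (1 - c * (t X + ∑ Y ∈ 𝒳 with (Y ≠ X ∧ ¬ M X Y), t Y)) := by
    rw [← sum_filter_add_sum_filter_not 𝒳 (fun X => 0 < 1 - c * (t X + ∑ Y ∈ 𝒳 with (Y ≠ X ∧ ¬ M X Y), t Y))]
    have hzero : ∑ X ∈ 𝒳 with ¬ (0 < 1 - c * (t X + ∑ Y ∈ 𝒳 with (Y ≠ X ∧ ¬ M X Y), t Y)),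
        t X * max 0 (1 - c * (t X + ∑ Y ∈ 𝒳 with (Y ≠ X ∧ ¬ M X Y), t Y)) = 0 :=
      sum_eq_zero fun X hX => by rw [max_eq_left (not_lt.1 (mem_filter.1 hX).2), mul_zero]
    rw [hzero, add_zero]
    exact sum_congr rfl fun X hX => by rw [max_eq_right (le_of_lt (mem_filter.1 hX).2)]
  rw [hsplit]
  have hmono : ∀ X ∈ 𝒳p, t X * (1 - c * (t X + ∑ Y ∈ 𝒳 with (Y ≠ X ∧ ¬ M X Y), t Y)) ≤
      t X * (1 - c * (t X + ∑ Y ∈ 𝒳p with (Y ≠ X ∧ ¬ M X Y), t Y)) := by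
    intro X hX
    have hle : ∑ Y ∈ 𝒳p with (Y ≠ X ∧ ¬ M X Y), t Y ≤ ∑ Y ∈ 𝒳 with (Y ≠ X ∧ ¬ M X Y), t Y :=
      sum_le_sum_of_subset_of_nonneg (fun Y hY => by
          rw [mem_filter] at hY ⊢
          exact ⟨hsub hY.1, hY.2⟩)
        fun Y hY _ => ht0 Y (mem_filter.1 hY).1
    have hcle : c * ∑ Y ∈ 𝒳p with (Y ≠ X ∧ ¬ M X Y), t Y ≤ c * ∑ Y ∈ 𝒳 with (Y ≠ X ∧ ¬ M X Y), t Y :=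
      mul_le_mul_of_nonneg_left hle hc.le
    exact mul_le_mul_of_nonneg_left (by linarith) (ht0 X (hsub hX))
  refine (sum_le_sum hmono).trans ?_
  -- now the quadratic bound on the sub-family
  have hsq := pool_group_sq_le 𝒳p t (fun X hX => ht0 X (hsub hX)) M
    (fun X hX Y hY h => hMsymm X (hsub hX) Y (hsub hY) h)
    (fun X hX => (card_le_card (fun Y hY => by
        rw [mem_filter] at hY ⊢
        exact ⟨hsub hY.1, hY.2⟩)).trans (hMuniq X (hsub hX)))
  have hexp : ∑ X ∈ 𝒳p, t X * (1 - c * (t X + ∑ Y ∈ 𝒳p with (Y ≠ X ∧ ¬ M X Y), t Y)) =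
      ∑ X ∈ 𝒳p, t X - c * ∑ X ∈ 𝒳p, t X * (t X + ∑ Y ∈ 𝒳p with (Y ≠ X ∧ ¬ M X Y), t Y) := by
    rw [mul_sum, ← sum_sub_distrib]
    exact sum_congr rfl fun X _ => by ring
  rw [hexp]
  set s := ∑ X ∈ 𝒳p, t X
  set Q := ∑ X ∈ 𝒳p, t X * (t X + ∑ Y ∈ 𝒳p with (Y ≠ X ∧ ¬ M X Y), t Y)
  -- `s − c Q ≤ s − c s²/2 ≤ 1/(2c)`
  have h1 : s - c * Q ≤ s - c * (s ^ 2 / 2) := by nlinarith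
  have h2 : s - c * (s ^ 2 / 2) ≤ 1 / (2 * c) := by
    rw [div_eq_mul_inv 1, one_mul, ← sub_nonneg]
    have hc' : (2 * c)⁻¹ = (2 * c)⁻¹ * (2 * c) * (2 * c)⁻¹ := by field_simp
    have key : 0 ≤ (c * s - 1) ^ 2 / (2 * c) := div_nonneg (sq_nonneg _) (by linarith)
    have : (c * s - 1) ^ 2 / (2 * c) = (2 * c)⁻¹ - (s - c * (s ^ 2 / 2)) := by
      field_simp
      ring
    linarith [this ▸ key]
  linarith

/-- **Cold hubs of the I₀-group (L7.3(i)): `Σ_X t_X [1 − P t_X − ½ P (s' − t_X)]⁺ ≤ 1/(2P)`** for `s' ≥ Σ t`, `P > 0`. -/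
theorem pool_cold_need_le (𝒳 : Finset ι) (t : ι → ℝ) (ht0 : ∀ X ∈ 𝒳, 0 ≤ t X) (P s' : ℝ) (hP : 0 < P)
    (hs' : ∑ X ∈ 𝒳, t X ≤ s') :
    ∑ X ∈ 𝒳, t X * max 0 (1 - P * t X - P * (s' - t X) / 2) ≤ 1 / (2 * P) := by
  classical
  set 𝒳p : Finset ι := {X ∈ 𝒳 | 0 < 1 - P * t X - P * (s' - t X) / 2} with h𝒳p
  have hsub : 𝒳p ⊆ 𝒳 := filter_subset _ _
  have hsplit : ∑ X ∈ 𝒳, t X * max 0 (1 - P * t X - P * (s' - t X) / 2) =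
      ∑ X ∈ 𝒳p, t X * (1 - P * t X - P * (s' - t X) / 2) := by
    rw [← sum_filter_add_sum_filter_not 𝒳 (fun X => 0 < 1 - P * t X - P * (s' - t X) / 2)]
    have hzero : ∑ X ∈ 𝒳 with ¬ (0 < 1 - P * t X - P * (s' - t X) / 2),
        t X * max 0 (1 - P * t X - P * (s' - t X) / 2) = 0 :=
      sum_eq_zero fun X hX => by rw [max_eq_left (not_lt.1 (mem_filter.1 hX).2), mul_zero]
    rw [hzero, add_zero]
    exact sum_congr rfl fun X hX => by rw [max_eq_right (le_of_lt (mem_filter.1 hX).2)]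
  rw [hsplit]
  set s := ∑ X ∈ 𝒳p, t X with hs
  have hss' : s ≤ s' := (sum_le_sum_of_subset_of_nonneg hsub fun X hX _ => ht0 X hX).trans hs'
  have hmono : ∀ X ∈ 𝒳p, t X * (1 - P * t X - P * (s' - t X) / 2) ≤ t X * (1 - P * s / 2) := by
    intro X hX
    have htX := ht0 X (hsub hX)
    have h1 : P * s ≤ P * s' := mul_le_mul_of_nonneg_left hss' hP.le
    have h2 : 0 ≤ P * t X := mul_nonneg hP.le htX
    exact mul_le_mul_of_nonneg_left (by linarith) htX
  refine (sum_le_sum hmono).trans ?_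
  rw [← sum_mul]
  -- `s (1 − P s/2) ≤ 1/(2P)`
  have : (P * s - 1) ^ 2 / (2 * P) = 1 / (2 * P) - s * (1 - P * s / 2) := by
    field_simp
    ring
  linarith [this ▸ div_nonneg (sq_nonneg (P * s - 1)) (by linarith : (0 : ℝ) ≤ 2 * P)]

/-- **Total of L7.3(i): `(P−1−T)/(2(P−1)) + T/(2P) ≤ 1/2`** for `P > 1`, `T ≥ 0`. -/
theorem pool_cold_total_le_half (P T : ℝ) (hP : 1 < P) (hT : 0 ≤ T) :
    (P - 1 - T) / (2 * (P - 1)) + T / (2 * P) ≤ 1 / 2 := by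
  rw [div_add_div _ _ (by linarith) (by linarith), div_le_iff₀ (by nlinarith)]
  nlinarith

end StarSet

end Summit.CriticalPhenomena.PercolationContinuityZ3.Theorems
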